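import Literature.AlgebraicTopology.SingularHomology.HurewiczSimplexClass
import HarnessLib

/-!
# The collapse of the cube onto the standard simplex, faces onto faces

Topic `Literature/AlgebraicTopology/SingularHomology`. The continuous surjection
`κₙ : Iⁿ → Δⁿ` (`CubeCollapse.collapse`),

  `κₙ(t)ⱼ = t₀ ⋯ tⱼ₋₁ (1 - tⱼ)` (`j < n`),  `κₙ(t)ₙ = t₀ ⋯ tₙ₋₁`,

i.e. `κₙ(t)ⱼ = Pⱼ - Pⱼ₊₁` with the partial products `Pⱼ = t₀ ⋯ tⱼ₋₁` (`P₀ = 1`, `Pₙ₊₁ := 0`). It maps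
`∂Iⁿ` onto `∂Δⁿ` and the interior bijectively onto the interior (`eq_of_collapse_eq`), so that
it is a quotient map inducing a homeomorphism `Iⁿ/∂Iⁿ ≅ Δⁿ/∂Δⁿ` — the dimension-`n` version of the
map `(s, t) ↦ (1 - s, s(1 - t), st)` of `HurewiczOne.lean` (`StdSimplex.squareToTwo`). Its point,
compared with the radial homeomorphism `cubeSimplexHomeo` of `HurewiczSimplexClass.lean`, is that
**the faces of the cube go to faces of the simplex** (`collapse_insertNth_one`: `{tₗ = 1} ↦ δₗ`;
`collapse_insertNth_last_zero`: `{tₙ = 0} ↦ δₙ₊₁`) or into the codimension-two skeleton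
(`collapse_insertNth_zero_mem_stdSkel`: `{tₗ = 0}`, `l < n`), which is what transports the
cubical homotopy addition theorem (`Homotopy/CubicalHomotopyAddition.lean`) to singular
simplices (`HomotopyAdditionProofs.lean`). Everything is elementary and proved; `[folklore]`
(these are the standard "collapsing" coordinates identifying `Iⁿ` with the simplex
`1 ≥ y₁ ≥ ⋯ ≥ yₙ ≥ 0`, `yⱼ = t₀ ⋯ tⱼ₋₁`).

## References

* E. H. Spanier, *Algebraic Topology*, Springer (1981), Ch. 7 §4, p. 391. [Spanier1981]
* A. Hatcher, *Algebraic Topology*, CUP (2002), §4.1, p. 340. [HatcherAT2002]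
-/

noncomputable section

open Set
open scoped unitInterval

namespace Literature.AlgebraicTopology.SingularHomology

namespace CubeCollapse

variable {n : ℕ}

/-! ### Coordinates and partial products -/

/-- The `m`-th coordinate of `t ∈ Iⁿ` as a real number, `0` for `m ≥ n`. [folklore] -/
def tval (t : Fin n → I) (m : ℕ) : ℝ := if h : m < n then (t ⟨m, h⟩ : ℝ) else 0

/-- `tval` below `n`. [folklore] -/
lemma tval_of_lt (t : Fin n → I) {m : ℕ} (h : m < n) : tval t m = t ⟨m, h⟩ := dif_pos h
/-- `tval` from `n` on. [folklore] -/
lemma tval_of_le (t : Fin n → I) {m : ℕ} (h : n ≤ m) : tval t m = 0 := dif_neg (not_lt.2 h)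

/-- `0 ≤ tval`. [folklore] -/
lemma tval_nonneg (t : Fin n → I) (m : ℕ) : 0 ≤ tval t m := by
  unfold tval; split_ifs with h
  · exact (t _).2.1
  · exact le_rfl

/-- `tval ≤ 1`. [folklore] -/
lemma tval_le_one (t : Fin n → I) (m : ℕ) : tval t m ≤ 1 := by
  unfold tval; split_ifs with h
  · exact (t _).2.2
  · exact zero_le_one

/-- `t ↦ tval t m` is continuous. [folklore] -/
lemma continuous_tval (m : ℕ) : Continuous fun t : Fin n → I => tval t m := by
  unfold tval; split_ifs with h
  · fun_prop
  · exact continuous_const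

/-- **The partial products** `Pⱼ(t) = t₀ ⋯ tⱼ₋₁` for `j ≤ n`, and `0` for `j > n`. [folklore] -/
def pp (t : Fin n → I) (j : ℕ) : ℝ := if j ≤ n then ∏ m ∈ Finset.range j, tval t m else 0

/-- `P₀ = 1`. [folklore] -/
@[simp] lemma pp_zero (t : Fin n → I) : pp t 0 = 1 := by simp [pp]
/-- `Pⱼ₊₁ = Pⱼ tⱼ` for `j < n`. [folklore] -/
lemma pp_succ (t : Fin n → I) {j : ℕ} (h : j < n) : pp t (j + 1) = pp t j * tval t j := by
  rw [pp, if_pos (by omega), pp, if_pos (by omega), Finset.prod_range_succ]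

/-- `Pⱼ = 0` for `j > n`. [folklore] -/
lemma pp_of_lt (t : Fin n → I) {j : ℕ} (h : n < j) : pp t j = 0 := by
  rw [pp, if_neg (by omega)]

/-- `0 ≤ Pⱼ`. [folklore] -/
lemma pp_nonneg (t : Fin n → I) (j : ℕ) : 0 ≤ pp t j := by
  unfold pp; split_ifs
  · exact Finset.prod_nonneg fun m _ => tval_nonneg t m
  · exact le_rfl

/-- `Pⱼ₊₁ ≤ Pⱼ`. [folklore] -/
lemma pp_succ_le (t : Fin n → I) (j : ℕ) : pp t (j + 1) ≤ pp t j := by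
  rcases lt_or_ge j n with h | h
  · rw [pp_succ t h]
    exact mul_le_of_le_one_right (pp_nonneg t j) (tval_le_one t j)
  · rw [pp_of_lt t (by omega)]; exact pp_nonneg t j

/-- Once a partial product vanishes, all later ones do. [folklore] -/
lemma pp_eq_zero_of_le (t : Fin n → I) {j₀ j : ℕ} (h0 : pp t j₀ = 0) (h : j₀ ≤ j) : pp t j = 0 := by
  induction h with
  | refl => exact h0
  | step _ ih => exact le_antisymm (ih ▸ pp_succ_le t _) (pp_nonneg t _)

/-- `t ↦ Pⱼ(t)` is continuous. [folklore] -/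
lemma continuous_pp (j : ℕ) : Continuous fun t : Fin n → I => pp t j := by
  unfold pp; split_ifs
  · exact continuous_finsetProd _ fun m _ => continuous_tval m
  · exact continuous_const

/-! ### The collapse map -/

/-- The barycentric coordinates of the collapse: `κ(t)ⱼ = Pⱼ - Pⱼ₊₁`. [folklore] -/
def coordFun (t : Fin n → I) (j : Fin (n + 1)) : ℝ := pp t j - pp t (j + 1)

/-- `κ(t)ⱼ = Pⱼ (1 - tⱼ)` for `j < n`. [folklore] -/
lemma coordFun_of_lt (t : Fin n → I) (j : Fin (n + 1)) (h : (j : ℕ) < n) :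
    coordFun t j = pp t j * (1 - t ⟨j, h⟩) := by
  rw [coordFun, pp_succ t h, tval_of_lt t h]; ring

/-- `κ(t)ₙ = Pₙ`. [folklore] -/
lemma coordFun_last (t : Fin n → I) : coordFun t (Fin.last n) = pp t n := by
  rw [coordFun, Fin.val_last, pp_of_lt t (Nat.lt_succ_self n), sub_zero]

/-- `0 ≤ κ(t)ⱼ`. [folklore] -/
lemma coordFun_nonneg (t : Fin n → I) (j : Fin (n + 1)) : 0 ≤ coordFun t j :=
  sub_nonneg.2 (pp_succ_le t j)

/-- `∑ⱼ κ(t)ⱼ = 1` (the sum telescopes to `P₀ - Pₙ₊₁ = 1`). [folklore] -/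
lemma sum_coordFun (t : Fin n → I) : ∑ j, coordFun t j = 1 := by
  unfold coordFun
  rw [Fin.sum_univ_eq_sum_range (fun j => pp t j - pp t (j + 1)) (n + 1), Finset.sum_range_sub',
    pp_zero, pp_of_lt t (Nat.lt_succ_self n), sub_zero]

/-- **The collapse `κₙ : Iⁿ → Δⁿ`**, `κₙ(t) = (Pⱼ - Pⱼ₊₁)ⱼ`, `Pⱼ = t₀ ⋯ tⱼ₋₁`. [folklore] -/
def collapse (t : Fin n → I) : StdSimplex n :=
  ⟨fun j => coordFun t j, fun j => coordFun_nonneg t j, sum_coordFun t⟩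

/-- The coordinates of the collapse. [folklore] -/
@[simp] lemma collapse_apply (t : Fin n → I) (j : Fin (n + 1)) :
    (collapse t : Fin (n + 1) → ℝ) j = pp t j - pp t (j + 1) := rfl

/-- **`κₙ` is continuous.** [folklore] -/
theorem continuous_collapse : Continuous (collapse (n := n)) := by
  unfold collapse coordFun
  refine Continuous.subtype_mk ?_ _
  exact continuous_pi fun j => (continuous_pp (j : ℕ)).sub (continuous_pp ((j : ℕ) + 1))

/-- **`κₙ` maps `∂Iⁿ` into `∂Δⁿ`**: if `tₗ = 1` then `κ(t)ₗ = 0`, if `tₗ = 0` then `κ(t)ₙ = 0`.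
[folklore] -/
theorem collapse_mem_stdBoundary {t : Fin n → I} (ht : t ∈ Cube.boundary (Fin n)) :
    collapse t ∈ stdBoundary n := by
  obtain ⟨l, hl | hl⟩ := ht
  · refine ⟨Fin.last n, ?_⟩
    change coordFun t (Fin.last n) = 0
    rw [coordFun_last]
    refine pp_eq_zero_of_le t ?_ (Nat.succ_le_of_lt l.2)
    rw [pp_succ t l.2, tval_of_lt t l.2, hl]; simp
  · refine ⟨l.castSucc, ?_⟩
    change coordFun t l.castSucc = 0
    rw [coordFun_of_lt t l.castSucc l.2]
    simp [hl]

/-- Off `∂Iⁿ`, all partial products `Pⱼ`, `j ≤ n`, are positive. [folklore] -/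
lemma pp_pos_of_not_mem {t : Fin n → I} (ht : t ∉ Cube.boundary (Fin n)) {j : ℕ} (hj : j ≤ n) :
    0 < pp t j := by
  induction j with
  | zero => simp
  | succ j ih =>
    rw [pp_succ t (by omega), tval_of_lt t (by omega)]
    exact mul_pos (ih (by omega))
      (lt_of_le_of_ne (t _).2.1 fun h => ht ⟨⟨j, by omega⟩, Or.inl (Subtype.ext h.symm)⟩)

/-- **`κₙ` maps the interior into the interior**: a point off `∂Iⁿ` goes off `∂Δⁿ`. [folklore] -/
theorem collapse_not_mem_stdBoundary {t : Fin n → I} (ht : t ∉ Cube.boundary (Fin n)) :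
    collapse t ∉ stdBoundary n := by
  rintro ⟨j, hj⟩
  change coordFun t j = 0 at hj
  rcases lt_or_eq_of_le (Nat.lt_succ_iff.1 j.2) with h | h
  · rw [coordFun_of_lt t j h] at hj
    rcases mul_eq_zero.1 hj with h' | h'
    · exact (pp_pos_of_not_mem ht h.le).ne' h'
    · exact ht ⟨⟨j, h⟩, Or.inr (Subtype.ext (by rw [Set.Icc.coe_one]; linarith))⟩
  · have hl : j = Fin.last n := Fin.ext h
    subst hl
    rw [coordFun_last] at hj
    exact (pp_pos_of_not_mem ht le_rfl).ne' hj

/-- The partial products are determined by the collapse: `Pⱼ₊₁ = Pⱼ - κ(t)ⱼ`. [folklore] -/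
lemma pp_eq_pp_of_collapse_eq {t t' : Fin n → I} (h : collapse t = collapse t') {j : ℕ} (hj : j ≤ n + 1) :
    pp t j = pp t' j := by
  induction j with
  | zero => simp
  | succ j ih =>
    have hc : coordFun t ⟨j, by omega⟩ = coordFun t' ⟨j, by omega⟩ :=
      congrFun (congrArg Subtype.val h) ⟨j, by omega⟩
    unfold coordFun at hc
    have := ih (by omega)
    change pp t j - pp t (j + 1) = pp t' j - pp t' (j + 1) at hc
    linarith

/-- **`κₙ` is injective off the boundary**: `κ(t) = κ(t')` with `t ∉ ∂Iⁿ` forces `t = t'`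
(`tⱼ = Pⱼ₊₁ / Pⱼ`). [folklore] -/
theorem eq_of_collapse_eq {t t' : Fin n → I} (h : collapse t = collapse t') (ht : t ∉ Cube.boundary (Fin n)) :
    t = t' := by
  funext ⟨m, hm⟩
  have h1 := pp_eq_pp_of_collapse_eq h (show m + 1 ≤ n + 1 by omega)
  rw [pp_succ t hm, pp_succ t' hm, pp_eq_pp_of_collapse_eq h (show m ≤ n + 1 by omega),
    tval_of_lt t hm, tval_of_lt t' hm] at h1
  have hpos : 0 < pp t' m := by
    rw [← pp_eq_pp_of_collapse_eq h (show m ≤ n + 1 by omega)]; exact pp_pos_of_not_mem ht hm.le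
  exact Subtype.ext (mul_left_cancel₀ hpos.ne' h1)

/-! ### Surjectivity -/

/-- The tail sums `Yⱼ = ∑_{i ≥ j} zᵢ` of a point of the simplex. [folklore] -/
def tailSum (z : StdSimplex n) (j : ℕ) : ℝ := ∑ i : Fin (n + 1), if j ≤ (i : ℕ) then (z : Fin (n + 1) → ℝ) i else 0

/-- `Y₀ = 1`. [folklore] -/
lemma tailSum_zero (z : StdSimplex n) : tailSum z 0 = 1 := by
  simp only [tailSum, zero_le, if_true]; exact z.2.2

/-- `Yⱼ = 0` for `j > n`. [folklore] -/
lemma tailSum_of_lt (z : StdSimplex n) {j : ℕ} (h : n < j) : tailSum z j = 0 :=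
  Finset.sum_eq_zero fun i _ => if_neg (by have := i.2; omega)

/-- `Yⱼ - Yⱼ₊₁ = zⱼ` for `j ≤ n`. [folklore] -/
lemma tailSum_sub (z : StdSimplex n) {j : ℕ} (h : j < n + 1) :
    tailSum z j - tailSum z (j + 1) = (z : Fin (n + 1) → ℝ) ⟨j, h⟩ := by
  rw [tailSum, tailSum, ← Finset.sum_sub_distrib,
    Finset.sum_eq_single_of_mem (⟨j, h⟩ : Fin (n + 1)) (Finset.mem_univ _)]
  · simp
  · intro i _ hi
    have hne : (i : ℕ) ≠ j := fun h' => hi (Fin.ext h')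
    by_cases h1 : j ≤ (i : ℕ)
    · rw [if_pos h1, if_pos (by omega), sub_self]
    · rw [if_neg h1, if_neg (by omega), sub_self]

/-- `0 ≤ Yⱼ`. [folklore] -/
lemma tailSum_nonneg (z : StdSimplex n) (j : ℕ) : 0 ≤ tailSum z j :=
  Finset.sum_nonneg fun i _ => by split_ifs; exacts [z.2.1 i, le_rfl]

/-- `Yⱼ₊₁ ≤ Yⱼ`. [folklore] -/
lemma tailSum_succ_le (z : StdSimplex n) (j : ℕ) : tailSum z (j + 1) ≤ tailSum z j := by
  rcases lt_or_ge j (n + 1) with h | h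
  · have h1 := tailSum_sub z h
    have h0 : 0 ≤ (z : Fin (n + 1) → ℝ) ⟨j, h⟩ := z.2.1 _
    linarith
  · rw [tailSum_of_lt z (by omega), tailSum_of_lt z (by omega)]

/-- A preimage of `z ∈ Δⁿ` under the collapse: `tₘ = Yₘ₊₁ / Yₘ` (and `0` where `Yₘ = 0`).
[folklore] -/
def lift (z : StdSimplex n) (m : Fin n) : I :=
  if tailSum z m = 0 then 0 else
    ⟨tailSum z (m + 1) / tailSum z m, div_nonneg (tailSum_nonneg z _) (tailSum_nonneg z _),
      div_le_one_of_le₀ (tailSum_succ_le z m) (tailSum_nonneg z _)⟩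

/-- The partial products of the lift are the tail sums. [folklore] -/
lemma pp_lift (z : StdSimplex n) {j : ℕ} (hj : j ≤ n) : pp (lift z) j = tailSum z j := by
  induction j with
  | zero => rw [pp_zero, tailSum_zero]
  | succ j ih =>
    rw [pp_succ _ (by omega), ih (by omega), tval_of_lt _ (by omega), lift]
    split_ifs with h
    · rw [h]
      have := tailSum_succ_le z j; have := tailSum_nonneg z (j + 1)
      change 0 * ((0 : I) : ℝ) = tailSum z (j + 1)
      simp only [Set.Icc.coe_zero, mul_zero]; linarith
    · change tailSum z j * (tailSum z (j + 1) / tailSum z j) = _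
      rw [mul_div_cancel₀ _ h]

/-- **`κₙ` is surjective.** [folklore] -/
theorem collapse_surjective : Function.Surjective (collapse (n := n)) := by
  intro z
  refine ⟨lift z, ?_⟩
  ext j
  rw [collapse_apply]
  rcases lt_or_eq_of_le (Nat.lt_succ_iff.1 j.2) with h | h
  · rw [pp_lift z (by omega), pp_lift z (by omega), tailSum_sub z j.2]
  · rw [pp_lift z (by omega), pp_of_lt _ (by omega), sub_zero, ← sub_zero (tailSum z j),
      ← tailSum_of_lt z (show n < j + 1 by omega), tailSum_sub z j.2]

/-- **`κₙ` is a quotient map** (a continuous surjection from a compact space to a Hausdorff space).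
[folklore] -/
theorem isQuotientMap_collapse : Topology.IsQuotientMap (collapse (n := n)) :=
  continuous_collapse.isClosedMap.isQuotientMap continuous_collapse collapse_surjective

/-! ### Faces of the cube go to faces of the simplex -/

section Faces

variable (l : Fin (n + 1)) (ε : I) (t' : Fin n → I)

/-- Coordinates of `insertNth l ε t'` below `l`. [folklore] -/
lemma tval_insertNth_of_lt {m : ℕ} (h : m < (l : ℕ)) :
    tval (Fin.insertNth (α := fun _ => I) l ε t') m = tval t' m := by
  have hm : m < n := lt_of_lt_of_le h (Nat.lt_succ_iff.1 l.2)
  rw [tval_of_lt _ (by omega), tval_of_lt _ hm]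
  have : (⟨m, by omega⟩ : Fin (n + 1)) = l.succAbove ⟨m, hm⟩ := by
    rw [Fin.succAbove_of_castSucc_lt _ _ (by rw [Fin.lt_def]; exact h)]; rfl
  rw [this, Fin.insertNth_apply_succAbove]

/-- The coordinate `l` of `insertNth l ε t'`. [folklore] -/
lemma tval_insertNth_self : tval (Fin.insertNth (α := fun _ => I) l ε t') l = ε := by
  rw [tval_of_lt _ l.2]
  exact congrArg Subtype.val (Fin.insertNth_apply_same (α := fun _ => I) l ε t')

/-- Coordinates of `insertNth l ε t'` above `l`. [folklore] -/
lemma tval_insertNth_of_gt {m : ℕ} (h : (l : ℕ) < m) :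
    tval (Fin.insertNth (α := fun _ => I) l ε t') m = tval t' (m - 1) := by
  rcases lt_or_ge m (n + 1) with hm | hm
  · rw [tval_of_lt _ hm, tval_of_lt _ (show m - 1 < n by omega)]
    have : (⟨m, hm⟩ : Fin (n + 1)) = l.succAbove ⟨m - 1, by omega⟩ := by
      rw [Fin.succAbove_of_le_castSucc _ _ (by rw [Fin.le_def]; change (l : ℕ) ≤ m - 1; omega)]
      ext; change m = m - 1 + 1; omega
    rw [this, Fin.insertNth_apply_succAbove]
  · rw [tval_of_le _ hm, tval_of_le _ (by omega)]

/-- Partial products of `insertNth l ε t'`: unchanged up to `l`, multiplied by `ε` and shifted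
beyond. [folklore] -/
lemma pp_insertNth (j : ℕ) :
    pp (Fin.insertNth (α := fun _ => I) l ε t') j = if j ≤ (l : ℕ) then pp t' j else ε * pp t' (j - 1) := by
  induction j with
  | zero => simp
  | succ j ih =>
    rcases lt_or_ge j (n + 1) with hj | hj
    · rw [pp_succ _ hj, ih]
      rcases lt_trichotomy j l with h | h | h
      · rw [if_pos h.le, if_pos (by omega), tval_insertNth_of_lt l ε t' h, pp_succ t' (by omega)]
      · subst h
        rw [if_pos le_rfl, if_neg (by omega), tval_insertNth_self, Nat.add_sub_cancel, mul_comm]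
      · rw [if_neg (by omega), if_neg (by omega), tval_insertNth_of_gt l ε t' h, mul_assoc,
          show j + 1 - 1 = (j - 1) + 1 by omega, pp_succ t' (by omega)]
    · rw [pp_of_lt _ (by omega), if_neg (by omega), pp_of_lt t' (by omega), mul_zero]

/-- **The face `{tₗ = 1}` of the cube goes to the face `δₗ` of the simplex**:
`κₙ₊₁ (insertNth l 1 t') = δₗ (κₙ t')`. [folklore] -/
theorem collapse_insertNth_one :
    collapse (Fin.insertNth (α := fun _ => I) l 1 t') = stdFace l.castSucc (collapse t') := by
  ext i
  rw [collapse_apply, pp_insertNth, pp_insertNth]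
  cases i using Fin.succAboveCases l.castSucc with
  | x =>
    rw [stdFace_apply_self, Fin.val_castSucc, if_pos le_rfl, if_neg (by omega), Set.Icc.coe_one,
      one_mul, Nat.add_sub_cancel, sub_self]
  | p c =>
    rw [stdFace_apply_succAbove, collapse_apply]
    rcases lt_or_ge (c : ℕ) l with h | h
    · rw [Fin.succAbove_of_castSucc_lt _ _ (by rw [Fin.lt_def]; exact h), Fin.val_castSucc,
        if_pos h.le, if_pos (by omega)]
    · rw [Fin.succAbove_of_le_castSucc _ _ (by rw [Fin.le_def]; exact h), Fin.val_succ,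
        if_neg (by omega), if_neg (by omega), Set.Icc.coe_one, one_mul, one_mul, Nat.add_sub_cancel,
        show (c : ℕ) + 1 + 1 - 1 = c + 1 by omega]

/-- **The face `{tₙ = 0}` of `Iⁿ⁺¹` goes to the last face `δₙ₊₁` of `Δⁿ⁺¹`**:
`κₙ₊₁ (insertNth (last n) 0 t') = δₙ₊₁ (κₙ t')`. [folklore] -/
theorem collapse_insertNth_last_zero (t' : Fin n → I) :
    collapse (Fin.insertNth (α := fun _ => I) (Fin.last n) 0 t') = stdFace (Fin.last (n + 1)) (collapse t') := by
  ext i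
  rw [collapse_apply, pp_insertNth, pp_insertNth, Fin.val_last]
  cases i using Fin.lastCases with
  | last =>
    rw [stdFace_apply_self, Fin.val_last, if_neg (by omega), if_neg (by omega), Set.Icc.coe_zero,
      zero_mul, zero_mul, sub_self]
  | cast c =>
    rw [← Fin.succAbove_last, stdFace_apply_succAbove, collapse_apply, Fin.succAbove_last,
      Fin.val_castSucc, if_pos (Nat.lt_succ_iff.1 c.2)]
    rcases lt_or_eq_of_le (Nat.lt_succ_iff.1 c.2) with h | h
    · rw [if_pos (by omega)]
    · rw [if_neg (by omega), h, Set.Icc.coe_zero, zero_mul, pp_of_lt t' (Nat.lt_succ_self n)]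

/-- **The faces `{tₗ = 0}`, `l < n`, of `Iⁿ⁺¹` go into the `l`-skeleton of `Δⁿ⁺¹`**: all
coordinates of `κₙ₊₁ (insertNth l 0 t')` beyond `l` vanish. [folklore] -/
theorem collapse_insertNth_zero_mem_stdSkel :
    collapse (Fin.insertNth (α := fun _ => I) l 0 t') ∈ stdSkel (n + 1) l := by
  rw [mem_stdSkel_iff]
  have hsub : StdSimplex.nzCoords (collapse (Fin.insertNth (α := fun _ => I) l 0 t')) ⊆
      Finset.univ.filter fun i : Fin (n + 2) => (i : ℕ) ≤ l := by
    intro i hi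
    rw [StdSimplex.mem_nzCoords, collapse_apply, pp_insertNth, pp_insertNth] at hi
    rw [Finset.mem_filter]
    refine ⟨Finset.mem_univ _, ?_⟩
    by_contra h
    rw [if_neg h, if_neg (by omega), Set.Icc.coe_zero, zero_mul, zero_mul, sub_self] at hi
    exact hi rfl
  refine (Finset.card_le_card hsub).trans ?_
  have : Finset.univ.filter (fun i : Fin (n + 2) => (i : ℕ) ≤ l) =
      Finset.image (Fin.castLE (by omega)) (Finset.univ : Finset (Fin ((l : ℕ) + 1))) := by
    ext i
    simp only [Finset.mem_filter, Finset.mem_univ, true_and, Finset.mem_image]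
    constructor
    · intro h; exact ⟨⟨i, by omega⟩, Fin.ext rfl⟩
    · rintro ⟨c, rfl⟩; exact Nat.lt_succ_iff.1 c.2
  rw [this]
  exact Finset.card_image_le.trans (by simp)

end Faces

end CubeCollapse

end Literature.AlgebraicTopology.SingularHomology

end
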